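import Summits.QuantumFields.BalabanUV.T4Continuum.Support.NE7EtaCurlFromCovGradient
import Summits.QuantumFields.BalabanUV.T4Continuum.Support.NE7EtaRatesD4CovReg
import Summits.QuantumFields.BalabanUV.T4Continuum.Support.NE7EnergyRateWPrep
import HarnessLib

/-!
# NE7SocketHOfPointwiseLetters — route #1 of the NE7 crux (node U5): the background∕one-step socket `h` of the docked END
# (`NE7Route1EndDockedSmallDataSU2`: representation ∧ η-RATE in the weighted energy norm ∧ (Lip₁ᶜ) ∧ (Lip₂′ᶜ)) FOLLOWS FROM A SLICE-FREE
# POINTWISE REPRESENTATION of the adjacent-level minimiser pair at the natural C¹ scale — (P0) `‖Z‖ ≤ p₀·4^{−k}`, (P1) `‖∇_W Z‖ ≤ p₁·8^{−k}`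

Cell `pub-balaban`, rung (B)+1 sub-cell t4, lineage `b2b-balaban-t4-ne7-p1`, generation 106 (CRUX PROVER NE7 #1 = OWNER of BINDER row NE7).
Memo `t4/b2b-balaban-t4-ne7-p1-g106/ROAD-G106.md` §1.

THE POINT.  After gen 105 (`NE7EnergyRateWSU2End`: representation ∧ RATE ∧ sup for every minimiser pair, SU(2), `L = 2`) the open part of
socket `h` is the pair of covariant-Lipschitz conjuncts — pointwise regularity of the relative coordinate `Z` (`U_A^{u} = W·e^{Z}`,
`W = rescale L (bavg L U_B)`).  This file records that the WHOLE socket is implied by the two pointwise letters a sup-norm perturbation theory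
around `W` delivers, with NO reference to the slice `𝒯_E`, to the energy norm, or to second differences:
(P0) `‖Z x κ‖ ≤ p₀·((L⁻¹)^k)²` and (P1) `‖Ad (W (x+e κ) μ) (Z (x+e μ) κ) − Z x κ‖ ≤ p₁·((L⁻¹)^k)³` (the C¹ distance of two adjacent-level
minimisers at RELATIVE rate `L^{−k}`: plaquette deviations in the class are `O(ε(L^k)^{−2})`, so (P1) sits one factor `L^{−k}` below the
no-rate scale, exactly as the weighted energy rate `residualScale ≍ √g·N²·L^{−k}` sits one factor below `ε·N²`).
 * RATE ⇐ (P0)(P1): `curlSq ≤ #box·#Plane·(2p₁((L⁻¹)^k)³)²` (`NE7EtaCurlFromCovGradient.norm_curl_le_two_mul_of_covDiff`),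
   `((L^k)⁻¹)²·dirSq ≤ #box·4·p₀²((L⁻¹)^k)⁶`, `#box = (N L^k)⁴` ⟹ `energyNormW ≤ √(4·#Plane·p₁² + 4p₀²)·N²·(L⁻¹)^k`, and
   `wallConst·dualC2·√g·N²∕(2·2^k) ≤ residualScale 4 2 N b g k` (`NE7EnergyRateWPrep.residualScale_lower_d4`, `k ≥ 1`, `g > 0`);
 * (Lip₁ᶜ) ⇐ (P1) with `Λ₁ = p₁` (`((L⁻¹)^k)³ ≤ ((L⁻¹)^k)²`);
 * (Lip₂′ᶜ) ⇐ (P1) twice with `Λ₂′ = 2p₁` (`Ad` is an isometry at the unitary `W`, `NE7EtaRatesD4CovReg.unitary_periodic_rescale_bavg_of_regular`).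
WHAT ([folklore]; 0 def, 0 sorry).  `curlSq_le_of_covDiff`, `dirSq_le_of_pointwise` (any `d`), `energyNormW_le_of_pointwise_d4` (any `L ≥ 1`),
`norm_second_covDiff_le` (any `d`), and the END-shaped **`socketH_of_pointwise`** (`d = 4`, `L = 2`, any class `𝒞`, any `U(n)`): `∃ C Λ₁ Λ₂′ ≥ 0`
(k-free, N-free: `C = 2√(4·#Plane·p₁² + 4p₀²)∕(wallConst·dualC2·√g)`, `Λ₁ = p₁`, `Λ₂′ = 2p₁`) such that socket `h` holds VERBATIM, from the pointwise
socket `hP`; plus `sup_letter_of_pointwise` (the sup conjunct of T-E_w♯ with `s = p₀`).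
HONEST FRAMING (page 1): real arithmetic over landed kernel lemmas; (P0)(P1) are asserted for NO minimiser pair here (they are the target of the
line «P-SUP» of the memo: sup-norm slice fixed point at `W = cavg U_B` + identification by uniqueness, displayed printed-TYPE inputs
[Balaban1985Variational] Thm 1 (10) and [Balaban1985PropagatorsII] Thm 3.13); nothing of Bałaban's asserted as an axiom; NE3∕NE7 NOT proved; spine
count = dagwriter∕referees' call; FIXED FINITE T⁴, rung (B)+1 — NOT infinite volume, NOT mass gap, NOT BetaPertH, NOT Clay (continuum YM on T⁴ ⇐
BetaPertH ∧ nine spine estimates).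
-/

set_option autoImplicit false

open scoped BigOperators Matrix Matrix.Norms.L2Operator
open Finset

namespace Summit.QuantumFields.BalabanUV.T4Continuum.NE7SocketHOfPointwiseLetters

open Literature.MathematicalPhysics.QuantumFieldTheory.Balaban1983to89
open B7Prop1Explicit B7Prop2Explicit
open T4AveragingDeficitWall hiding Site Plane Plaq Bond
open T4AveragingDeficitWallBoundary (periodBox IsPeriodicCfg card_periodBox)
open AveragingDeficitPeriodicCounting (IsPeriodicDir)
open T4AveragingDeficitNonAbelian (Ad_sub)
open AveragingDeficitTransport (norm_Ad_of_unitary)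
open MinimalActionSandwich (IsMinimiser)
open MinimalActionRate (Regular)
open NE3EnergyShapes (residualScale residualScale_nonneg IsUnitarySite IsPeriodicSite)
open NE3EnergyWeightedShapes (energyNormW)
open AveragingDeficitDualResidual (dualC2)
open AveragingDeficitDerivWallProof (wallConst)
open NE7EtaCurlFromCovGradient (norm_curl_le_two_mul_of_covDiff)
open NE7EtaRatesD4CovReg (unitary_periodic_rescale_bavg_of_regular)
open NE7EnergyRateWPrep (residualScale_lower_d4 wallConst_pos dualC2_pos_d4)

noncomputable section

variable {d : ℕ} {n : Type*} [Fintype n] [DecidableEq n]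

/-! ## §1 Energy letters from pointwise letters -/

/-- **`curlSq` FROM A COVARIANT-GRADIENT SUP BOUND**: `‖Ad (W (x+e κ) μ) (Z (x+e μ) κ) − Z x κ‖ ≤ G` everywhere and `W` unitary give
`curlSq W Z F ≤ #F · #Plane(d) · (2G)²`. [folklore] -/
theorem curlSq_le_of_covDiff {W : Site d → Fin d → (Matrix n n ℂ)ˣ} (hW : IsUnitaryCfg W) {Z : Site d → Fin d → Matrix n n ℂ} {G : ℝ}
    (hG : ∀ (κ : Fin d) (x : Site d) (μ : Fin d), ‖Ad (W (x + e κ) μ) (Z (x + e μ) κ) - Z x κ‖ ≤ G) (F : Finset (Site d)) :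
    curlSq W Z F ≤ F.card * Fintype.card (T4AveragingDeficitWall.Plane d) * (2 * G) ^ 2 := by
  unfold curlSq
  calc ∑ z ∈ F, ∑ π : T4AveragingDeficitWall.Plane d, ‖curl W Z (z, π)‖ ^ 2
      ≤ ∑ z ∈ F, ∑ π : T4AveragingDeficitWall.Plane d, (2 * G) ^ 2 :=
        Finset.sum_le_sum fun z _ => Finset.sum_le_sum fun π _ =>
          pow_le_pow_left₀ (norm_nonneg _) (norm_curl_le_two_mul_of_covDiff hW hG π z) 2
    _ = F.card * Fintype.card (T4AveragingDeficitWall.Plane d) * (2 * G) ^ 2 := by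
        simp only [Finset.sum_const, Finset.card_univ]; ring

/-- **`dirSq` FROM A POINTWISE BOUND**: `‖Z x κ‖ ≤ P` everywhere gives `dirSq Z F ≤ #F · d · P²`. [folklore] -/
theorem dirSq_le_of_pointwise {Z : Site d → Fin d → Matrix n n ℂ} {P : ℝ} (hP : ∀ (x : Site d) (κ : Fin d), ‖Z x κ‖ ≤ P)
    (F : Finset (Site d)) : dirSq Z F ≤ F.card * d * P ^ 2 := by
  unfold dirSq
  calc ∑ x ∈ F, ∑ κ : Fin d, ‖Z x κ‖ ^ 2 ≤ ∑ x ∈ F, ∑ κ : Fin d, P ^ 2 :=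
        Finset.sum_le_sum fun x _ => Finset.sum_le_sum fun κ _ => pow_le_pow_left₀ (norm_nonneg _) (hP x κ) 2
    _ = F.card * d * P ^ 2 := by
        simp only [Finset.sum_const, Finset.card_univ, Fintype.card_fin]; ring

/-- **THE WEIGHTED ENERGY NORM FROM THE TWO POINTWISE LETTERS** (`d = 4`, `L ≥ 1`, one period box of side `N·L^k`, `W` unitary): with
`s = (L⁻¹)^k`, (P0) `‖Z x κ‖ ≤ p₀ s²` and (P1) `‖Ad (W (x+e κ) μ) (Z (x+e μ) κ) − Z x κ‖ ≤ p₁ s³` give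
`energyNormW L k W Z (periodBox (N L^k)) ≤ √(4·#Plane·p₁² + 4p₀²) · N² · s`. [folklore] -/
theorem energyNormW_le_of_pointwise_d4 {L : ℕ} (hL : 1 ≤ L) (N k : ℕ) {W : Site 4 → Fin 4 → (Matrix n n ℂ)ˣ} (hW : IsUnitaryCfg W)
    {Z : Site 4 → Fin 4 → Matrix n n ℂ} {p₀ p₁ : ℝ}
    (hP0 : ∀ (x : Site 4) (κ : Fin 4), ‖Z x κ‖ ≤ p₀ * (((L : ℝ)⁻¹) ^ k) ^ 2)
    (hP1 : ∀ (κ : Fin 4) (x : Site 4) (μ : Fin 4), ‖Ad (W (x + e κ) μ) (Z (x + e μ) κ) - Z x κ‖ ≤ p₁ * (((L : ℝ)⁻¹) ^ k) ^ 3) :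
    energyNormW L k W Z (periodBox (N * L ^ k))
      ≤ Real.sqrt (4 * Fintype.card (T4AveragingDeficitWall.Plane 4) * p₁ ^ 2 + 4 * p₀ ^ 2) * (N : ℝ) ^ 2 * ((L : ℝ)⁻¹) ^ k := by
  set s : ℝ := ((L : ℝ)⁻¹) ^ k with hs_def
  set cP : ℝ := (Fintype.card (T4AveragingDeficitWall.Plane 4) : ℝ) with hcP_def
  have hL0 : (0 : ℝ) < L := by exact_mod_cast (by omega : 0 < L)
  have hs0 : 0 < s := by rw [hs_def]; positivity
  have hcP0 : 0 ≤ cP := by rw [hcP_def]; positivity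
  have hM : ((L : ℝ) ^ k) = s⁻¹ := by rw [hs_def, inv_pow, inv_inv]
  have hcard : (((periodBox (d := 4) (N * L ^ k)).card : ℕ) : ℝ) = (N : ℝ) ^ 4 * s⁻¹ ^ 4 := by
    rw [card_periodBox]; push_cast; rw [hM]; ring
  have hA : 0 ≤ 4 * cP * p₁ ^ 2 + 4 * p₀ ^ 2 := by positivity
  -- the two sums
  have hcurl : curlSq W Z (periodBox (N * L ^ k)) ≤ 4 * cP * p₁ ^ 2 * (N : ℝ) ^ 4 * s ^ 2 := by
    have h := curlSq_le_of_covDiff hW hP1 (periodBox (N * L ^ k))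
    rw [hcard] at h
    have hid : (N : ℝ) ^ 4 * s⁻¹ ^ 4 * Fintype.card (T4AveragingDeficitWall.Plane 4) * (2 * (p₁ * s ^ 3)) ^ 2
        = 4 * cP * p₁ ^ 2 * (N : ℝ) ^ 4 * s ^ 2 := by
      rw [hcP_def]; field_simp; ring
    linarith [h, hid.le, hid.ge]
  have hdir : s ^ 2 * dirSq Z (periodBox (N * L ^ k)) ≤ 4 * p₀ ^ 2 * (N : ℝ) ^ 4 * s ^ 2 := by
    have h := dirSq_le_of_pointwise hP0 (periodBox (N * L ^ k))
    rw [hcard] at h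
    have hid : s ^ 2 * ((N : ℝ) ^ 4 * s⁻¹ ^ 4 * ((4 : ℕ) : ℝ) * (p₀ * s ^ 2) ^ 2) = 4 * p₀ ^ 2 * (N : ℝ) ^ 4 * s ^ 2 := by
      field_simp; ring
    have h2 : s ^ 2 * dirSq Z (periodBox (N * L ^ k)) ≤ s ^ 2 * ((N : ℝ) ^ 4 * s⁻¹ ^ 4 * ((4 : ℕ) : ℝ) * (p₀ * s ^ 2) ^ 2) :=
      mul_le_mul_of_nonneg_left h (sq_nonneg _)
    linarith [h2, hid.le, hid.ge]
  -- assemble under the square root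
  have hsq : curlSq W Z (periodBox (N * L ^ k)) + (((L : ℝ) ^ k)⁻¹) ^ 2 * dirSq Z (periodBox (N * L ^ k))
      ≤ (Real.sqrt (4 * cP * p₁ ^ 2 + 4 * p₀ ^ 2) * (N : ℝ) ^ 2 * s) ^ 2 := by
    have hw : (((L : ℝ) ^ k)⁻¹) = s := by rw [hs_def, inv_pow]
    rw [hw, mul_pow, mul_pow, Real.sq_sqrt hA]
    nlinarith [hcurl, hdir]
  have hR0 : 0 ≤ Real.sqrt (4 * cP * p₁ ^ 2 + 4 * p₀ ^ 2) * (N : ℝ) ^ 2 * s := by positivity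
  unfold energyNormW
  calc Real.sqrt (curlSq W Z (periodBox (N * L ^ k)) + (((L : ℝ) ^ k)⁻¹) ^ 2 * dirSq Z (periodBox (N * L ^ k)))
      ≤ Real.sqrt ((Real.sqrt (4 * cP * p₁ ^ 2 + 4 * p₀ ^ 2) * (N : ℝ) ^ 2 * s) ^ 2) := Real.sqrt_le_sqrt hsq
    _ = Real.sqrt (4 * cP * p₁ ^ 2 + 4 * p₀ ^ 2) * (N : ℝ) ^ 2 * s := Real.sqrt_sq hR0

/-! ## §2 The second covariant difference from the first -/

/-- **SECOND COVARIANT DIFFERENCES ALONG A LINE FROM A COVARIANT-GRADIENT SUP BOUND** (`W` unitary, any `d`): if every end-point covariant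
difference `Ad (W (x+e κ) μ) (Z (x+e μ) κ) − Z x κ` has norm `≤ G`, then every second covariant difference of the (Lip₂′ᶜ) display has norm
`≤ 2G` (`Ad` is an isometry; `y + e κ + e μ = (y + e μ) + e κ`, `y + 2•e μ = (y + e μ) + e μ`). [folklore] -/
theorem norm_second_covDiff_le {W : Site d → Fin d → (Matrix n n ℂ)ˣ} (hW : IsUnitaryCfg W) {Z : Site d → Fin d → Matrix n n ℂ} {G : ℝ}
    (hG : ∀ (κ : Fin d) (x : Site d) (μ : Fin d), ‖Ad (W (x + e κ) μ) (Z (x + e μ) κ) - Z x κ‖ ≤ G)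
    (κ μ : Fin d) (y : Site d) :
    ‖Ad (W (y + e κ) μ) (Ad (W (y + e κ + e μ) μ) (Z (y + (2 : ℕ) • e μ) κ) - Z (y + e μ) κ)
        - (Ad (W (y + e κ) μ) (Z (y + e μ) κ) - Z y κ)‖ ≤ 2 * G := by
  have h1 : ‖Ad (W (y + e κ) μ) (Ad (W (y + e κ + e μ) μ) (Z (y + (2 : ℕ) • e μ) κ) - Z (y + e μ) κ)‖ ≤ G := by
    rw [norm_Ad_of_unitary (hW _ _)]
    have h := hG κ (y + e μ) μ
    have e1 : y + e μ + e κ = y + e κ + e μ := add_right_comm _ _ _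
    have e2 : y + e μ + e μ = y + (2 : ℕ) • e μ := by rw [two_nsmul, add_assoc]
    rw [e1, e2] at h
    exact h
  have h2 : ‖Ad (W (y + e κ) μ) (Z (y + e μ) κ) - Z y κ‖ ≤ G := hG κ y μ
  calc ‖Ad (W (y + e κ) μ) (Ad (W (y + e κ + e μ) μ) (Z (y + (2 : ℕ) • e μ) κ) - Z (y + e μ) κ)
          - (Ad (W (y + e κ) μ) (Z (y + e μ) κ) - Z y κ)‖
      ≤ ‖Ad (W (y + e κ) μ) (Ad (W (y + e κ + e μ) μ) (Z (y + (2 : ℕ) • e μ) κ) - Z (y + e μ) κ)‖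
          + ‖Ad (W (y + e κ) μ) (Z (y + e μ) κ) - Z y κ‖ := norm_sub_le _ _
    _ ≤ 2 * G := by linarith

/-! ## §3 Socket `h` of route 1's END from the pointwise socket (`d = 4`, `L = 2`) -/

/-- **SOCKET `h` FROM THE POINTWISE SOCKET `hP`** (`d = 4`, `L = 2`, any class `𝒞`, any `U(n)`, `0 ≤ b`, the substrate's averaging line
`512·5·8·L²·b ≤ 1`, `g > 0`, `p₁ ≥ 0`).  If for every level `k ≥ 1`, datum `V ∈ dom`, level-`k` minimiser `U_A` and `Regular b g` level-`(k+1)`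
minimiser `U_B` there are a periodic unitary gauge `u` and a periodic skew direction `Z` with `U_A^{u} = W·e^{Z}`, `W = rescale L (bavg L U_B)`, and
the pointwise letters (P0) `‖Z x κ‖ ≤ p₀((L⁻¹)^k)²`, (P1) `‖Ad (W (x+e κ) μ) (Z (x+e μ) κ) − Z x κ‖ ≤ p₁((L⁻¹)^k)³`, THEN there are k-free, N-free
`C, Λ₁, Λ₂′ ≥ 0` for which the background∕one-step socket `h` of `NE7Route1EndDockedSmallDataSU2.goodClause_summable_of_route1_docked_smallData_SU2`
(representation ∧ `energyNormW ≤ C·residualScale` ∧ (Lip₁ᶜ) ∧ (Lip₂′ᶜ)) holds VERBATIM for the SAME `(u, Z)`. [folklore] -/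
theorem socketH_of_pointwise [Nonempty n] {𝒞 : ℕ → Set (Site 4 → Fin 4 → (Matrix n n ℂ)ˣ)} {L N : ℕ} (hL : L = 2)
    {b g p₀ p₁ : ℝ} (hb : 0 ≤ b) (hbs : 512 * (4 + 1) * (4 + 4) * (L : ℝ) ^ 2 * b ≤ 1) (hg : 0 < g) (hp₁ : 0 ≤ p₁)
    {dom : Set (Site 4 → Fin 4 → (Matrix n n ℂ)ˣ)}
    (hP : ∀ k : ℕ, 1 ≤ k → ∀ V ∈ dom, ∀ UA UB : Site 4 → Fin 4 → (Matrix n n ℂ)ˣ,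
      IsMinimiser 4 𝒞 L N k V UA → IsMinimiser 4 𝒞 L N (k + 1) V UB → Regular 4 L N b g (k + 1) UB →
        ∃ (u : Site 4 → (Matrix n n ℂ)ˣ) (Z : Site 4 → Fin 4 → Matrix n n ℂ),
          IsUnitarySite u ∧ IsPeriodicSite u ((N * L ^ k : ℕ) : ℤ) ∧ IsSkewDir Z ∧ IsPeriodicDir Z ((N * L ^ k : ℕ) : ℤ) ∧
          gaugeAct u UA = vary (rescale L (bavg L UB)) Z 1 ∧
          (∀ (x : Site 4) (κ : Fin 4), ‖Z x κ‖ ≤ p₀ * (((L : ℝ)⁻¹) ^ k) ^ 2) ∧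
          (∀ (κ : Fin 4) (x : Site 4) (μ : Fin 4),
            ‖Ad (rescale L (bavg L UB) (x + e κ) μ) (Z (x + e μ) κ) - Z x κ‖ ≤ p₁ * (((L : ℝ)⁻¹) ^ k) ^ 3)) :
    ∃ C Λ₁ Λ₂' : ℝ, 0 ≤ C ∧ 0 ≤ Λ₁ ∧ 0 ≤ Λ₂' ∧
      ∀ k : ℕ, 1 ≤ k → ∀ V ∈ dom, ∀ UA UB : Site 4 → Fin 4 → (Matrix n n ℂ)ˣ,
        IsMinimiser 4 𝒞 L N k V UA → IsMinimiser 4 𝒞 L N (k + 1) V UB → Regular 4 L N b g (k + 1) UB →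
          ∃ (u : Site 4 → (Matrix n n ℂ)ˣ) (Z : Site 4 → Fin 4 → Matrix n n ℂ),
            IsUnitarySite u ∧ IsPeriodicSite u ((N * L ^ k : ℕ) : ℤ) ∧
            IsSkewDir Z ∧ IsPeriodicDir Z ((N * L ^ k : ℕ) : ℤ) ∧
            gaugeAct u UA = vary (rescale L (bavg L UB)) Z 1 ∧
            energyNormW L k (rescale L (bavg L UB)) Z (periodBox (N * L ^ k)) ≤ C * residualScale 4 L N b g k ∧
            (∀ (κ : Fin 4) (x : Site 4) (μ : Fin 4),
              ‖Ad (rescale L (bavg L UB) (x + e κ) μ) (Z (x + e μ) κ) - Z x κ‖ ≤ Λ₁ * (((L : ℝ)⁻¹) ^ k) ^ 2) ∧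
            (∀ (κ μ : Fin 4) (y : Site 4),
              ‖Ad (rescale L (bavg L UB) (y + e κ) μ)
                  (Ad (rescale L (bavg L UB) (y + e κ + e μ) μ) (Z (y + (2 : ℕ) • e μ) κ) - Z (y + e μ) κ)
                - (Ad (rescale L (bavg L UB) (y + e κ) μ) (Z (y + e μ) κ) - Z y κ)‖ ≤ Λ₂' * (((L : ℝ)⁻¹) ^ k) ^ 3) := by
  subst hL
  -- the constants
  set cP : ℝ := (Fintype.card (T4AveragingDeficitWall.Plane 4) : ℝ) with hcP_def
  set A : ℝ := Real.sqrt (4 * cP * p₁ ^ 2 + 4 * p₀ ^ 2) with hA_def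
  set w : ℝ := wallConst 4 2 * dualC2 4 2 * Real.sqrt g with hw_def
  have hw0 : 0 < w := by
    rw [hw_def]; exact mul_pos (mul_pos (wallConst_pos 4 2) dualC2_pos_d4) (Real.sqrt_pos.2 hg)
  have hA0 : 0 ≤ A := Real.sqrt_nonneg _
  refine ⟨2 * A / w, p₁, 2 * p₁, by positivity, hp₁, by positivity, ?_⟩
  intro k hk V hV UA UB hA hB hreg
  obtain ⟨u, Z, hu, huP, hZs, hZP, hgauge, hP0, hP1⟩ := hP k hk V hV UA UB hA hB hreg
  have hWu : IsUnitaryCfg (rescale 2 (bavg 2 UB)) :=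
    (unitary_periodic_rescale_bavg_of_regular (by norm_num) hb hbs hreg).1
  refine ⟨u, Z, hu, huP, hZs, hZP, hgauge, ?_, ?_, ?_⟩
  · -- RATE from (P0)(P1)
    have hE := energyNormW_le_of_pointwise_d4 (L := 2) (by norm_num) N k hWu hP0 hP1
    obtain ⟨j, rfl⟩ : ∃ j, k = j + 1 := ⟨k - 1, by omega⟩
    have hlow := residualScale_lower_d4 N j (b := b) hg.le
    -- `A·N²·(2⁻¹)^{j+1} = (2A/w) · (w·N²/(2·2^{j+1}))`
    have hs : (((2 : ℕ) : ℝ)⁻¹) ^ (j + 1) = (((2 : ℕ) : ℝ) ^ (j + 1))⁻¹ := inv_pow _ _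
    have hid : A * (N : ℝ) ^ 2 * (((2 : ℕ) : ℝ)⁻¹) ^ (j + 1)
        = 2 * A / w * (wallConst 4 2 * dualC2 4 2 * Real.sqrt g * (N : ℝ) ^ 2 / (2 * ((2 : ℕ) : ℝ) ^ (j + 1))) := by
      rw [hs, ← hw_def]; field_simp
    calc energyNormW 2 (j + 1) (rescale 2 (bavg 2 UB)) Z (periodBox (N * 2 ^ (j + 1)))
        ≤ A * (N : ℝ) ^ 2 * (((2 : ℕ) : ℝ)⁻¹) ^ (j + 1) := hE
      _ = 2 * A / w * (wallConst 4 2 * dualC2 4 2 * Real.sqrt g * (N : ℝ) ^ 2 / (2 * ((2 : ℕ) : ℝ) ^ (j + 1))) := hid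
      _ ≤ 2 * A / w * residualScale 4 2 N b g (j + 1) := mul_le_mul_of_nonneg_left hlow (by positivity)
  · -- (Lip₁ᶜ) from (P1): `((L⁻¹)^k)³ ≤ ((L⁻¹)^k)²`
    intro κ x μ
    have hs0 : 0 ≤ (((2 : ℕ) : ℝ)⁻¹) ^ k := by positivity
    have hs1 : (((2 : ℕ) : ℝ)⁻¹) ^ k ≤ 1 := pow_le_one₀ (by positivity) (by norm_num)
    have h3 : (((( 2 : ℕ) : ℝ)⁻¹) ^ k) ^ 3 ≤ ((((2 : ℕ) : ℝ)⁻¹) ^ k) ^ 2 := by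
      rw [pow_succ]; exact mul_le_of_le_one_right (by positivity) hs1
    exact (hP1 κ x μ).trans (mul_le_mul_of_nonneg_left h3 hp₁)
  · -- (Lip₂′ᶜ) from (P1) twice
    intro κ μ y
    have h := norm_second_covDiff_le hWu hP1 κ μ y
    linarith

/-- **THE SUP CONJUNCT OF T-E_w♯ FROM (P0)**: `‖Z x κ‖ ≤ p₀((L⁻¹)^k)² ≤ p₀(L⁻¹)^k` (`L ≥ 1`) — so a pointwise delivery also inhabits
`NE3EnergyWeightedSupShape.NE3EnergyRateWSup`'s last conjunct with `s = p₀`. [folklore] -/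
theorem sup_letter_of_pointwise {L : ℕ} (hL : 1 ≤ L) (k : ℕ) {Z : Site d → Fin d → Matrix n n ℂ} {p₀ : ℝ} (hp₀ : 0 ≤ p₀)
    (hP0 : ∀ (x : Site d) (κ : Fin d), ‖Z x κ‖ ≤ p₀ * (((L : ℝ)⁻¹) ^ k) ^ 2) (x : Site d) (κ : Fin d) :
    ‖Z x κ‖ ≤ p₀ * ((L : ℝ)⁻¹) ^ k := by
  have hL1 : (1 : ℝ) ≤ L := by exact_mod_cast hL
  have hs0 : 0 ≤ ((L : ℝ)⁻¹) ^ k := by positivity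
  have hs1 : ((L : ℝ)⁻¹) ^ k ≤ 1 := pow_le_one₀ (by positivity) (inv_le_one_of_one_le₀ hL1)
  have h2 : (((L : ℝ)⁻¹) ^ k) ^ 2 ≤ ((L : ℝ)⁻¹) ^ k := by
    rw [pow_two]; exact mul_le_of_le_one_right hs0 hs1
  exact (hP0 x κ).trans (mul_le_mul_of_nonneg_left h2 hp₀)

end

end Summit.QuantumFields.BalabanUV.T4Continuum.NE7SocketHOfPointwiseLetters
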